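import Summits.AtomisticToContinuum.HydrodynamicLimit.Theorems.CollisionIsometryCLTAdaptedWeightCLTBlockHDissipation
import Summits.AtomisticToContinuum.HydrodynamicLimit.Theorems.DiffuseBackwardInfluence.Negative.TransferKernels
import Summits.AtomisticToContinuum.HydrodynamicLimit.Theorems.CollisionIsometryCLTAdaptedWeightCLTSAWindowMeasurable

/-!
# Stub `stub_contactToMass` (S4) of the line `block-h-dissipation-closure`, helper file 1: the idle-fraction
dictionary of H1 and the diagonal-sequence lemma
(crux `CollisionIsometryCLT.AdaptedWeightCLT`, stmt-AtomisticToContinuum-14868; `--supports`, anchor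
`bhContactToMass_idle_anchor`)

Two pieces of bookkeeping that every proof of S4 (`ChaosSmallOn ⇒ DissipSmallOn` from H1) consumes.

* THE IDLE-FRACTION DICTIONARY OF H1 (fold level). The crux's `iprF` (module `…AdaptedWeightCLTLine`) and the
  disprover's `DiffuseBackwardInfluenceNeg.ipr` (`…/Negative/TransferKernels.lean`) are the same verbatim copy of
  the crux's `let ipr` (`iprF_eq_ipr`, `rfl`), so `9 · idleFrac ≤ iprF` (`nine_mul_idleFrac_le_ipr`: a particle
  that belongs to no reflected pair of the fold keeps an identity row of participation `9`). Hence H1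
  (`DiffuseAt`: the mean window ipr tends to `0` on every admissible window `Δ_N → 0`, `Δ_N (N+1)^{1/3} → ∞`,
  at every window end `t > 0`) gives: the mean idle fraction tends to `0` (`tendsto_lintegral_idleFrac`) and, by
  Markov, `P{ε < idleFrac} → 0` for every `ε > 0` (`tendsto_measure_idleFrac_gt`); the event `{ε < idleFrac}`
  need not be measurable (it is bounded by the measurable event `{9ε < iprF}`, `measurable_iprF`).
* THE DIAGONAL SEQUENCE (`exists_diag_seq`): if `u η N → 0` as `N → ∞` for every fixed level `η > 0`, there is
  a sequence of levels `η_N → 0`, `η_N > 0`, along which `u η_N N → 0` (used with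
  `u η N = P_N{η (N+1)^{1/3} < chaosDiss}` from `ChaosSmallOn`, the windows being chosen after `η_N`).
-/

namespace Summit.AtomisticToContinuum.HydrodynamicLimit.Theorems.BlockHDissipation

open scoped BigOperators Topology Classical MeasureTheory ENNReal InnerProductSpace
open Filter Set MeasureTheory
open Literature.Analysis.FluidPDE
open Summit.AtomisticToContinuum.HydrodynamicLimit.Theorems.ContactSourceDuhamel (T3 V3 Cfg Vel Flow Flows iprF)
open Summit.AtomisticToContinuum.HydrodynamicLimit.Theorems.ContactSourceDuhamel.TimeLocal
open Summit.AtomisticToContinuum.HydrodynamicLimit.Theorems.DiffuseBackwardInfluenceNeg (idleFrac idleCount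
  idleSet nine_mul_idleFrac_le_ipr)
open Literature.MathematicalPhysics.KineticTheory (hsDiameter hsDiameter_le localGibbsLaw)

noncomputable section

namespace ContactToMass

variable {σ : ℝ} {N : ℕ}

/-! ## The two verbatim copies of the crux's `ipr` agree -/

/-- The crux's window ipr `iprF` (line vocabulary) IS the disprover's `ipr` (both are verbatim copies of the
crux's `let M; let ipr`). -/
theorem iprF_eq_ipr (σ : ℝ) (N : ℕ) (y : Cfg N) (Δ : ℝ) :
    iprF σ N y Δ = DiffuseBackwardInfluenceNeg.ipr σ N y Δ :=
  rfl

/-- `9 · idleFrac ≤ iprF`: idle particles keep an identity row of participation `9`. -/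
theorem nine_mul_idleFrac_le_iprF (σ : ℝ) (N : ℕ) (y : Cfg N) (Δ : ℝ) :
    9 * idleFrac σ N y Δ ≤ iprF σ N y Δ := by
  rw [iprF_eq_ipr]
  exact nine_mul_idleFrac_le_ipr σ N y Δ

/-- The idle fraction is nonnegative. -/
theorem idleFrac_nonneg (σ : ℝ) (N : ℕ) (y : Cfg N) (Δ : ℝ) : 0 ≤ idleFrac σ N y Δ := by
  unfold idleFrac
  positivity

/-- The idle fraction is at most `1` (at most `N + 1` idle particles). -/
theorem idleFrac_le_one (σ : ℝ) (N : ℕ) (y : Cfg N) (Δ : ℝ) : idleFrac σ N y Δ ≤ 1 := by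
  unfold idleFrac idleCount
  have hN : (0 : ℝ) < ((N + 1 : ℕ) : ℝ) := by positivity
  rw [div_le_one hN]
  have h : Nat.card (idleSet σ N y Δ) ≤ N + 1 := by
    have h1 := Nat.card_le_card_of_injective (Subtype.val : idleSet σ N y Δ → Fin (N + 1))
      Subtype.val_injective
    simpa only [Nat.card_eq_fintype_card, Fintype.card_fin] using h1
  exact_mod_cast h

/-! ## H1 ⇒ the idle fraction is small on every admissible window -/

/-- Pointwise: `9 E[idleFrac] ≤ E[iprF]` along the flow at the window `[t − Δ, t]` (no measurability needed:
`lintegral` is monotone on arbitrary functions). -/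
theorem lintegral_idleFrac_le (Φ : Flows σ) (P : Measure (Cfg N)) (Δ t : ℝ) :
    9 * ∫⁻ z, ENNReal.ofReal (idleFrac σ N ((Φ N).flow (t - Δ) z) Δ) ∂P ≤
      ∫⁻ z, ENNReal.ofReal (iprF σ N ((Φ N).flow (t - Δ) z) Δ) ∂P := by
  rw [← lintegral_const_mul' _ _ (by norm_num : (9 : ℝ≥0∞) ≠ ∞)]
  refine lintegral_mono fun z => ?_
  rw [show (9 : ℝ≥0∞) = ENNReal.ofReal 9 by norm_num, ← ENNReal.ofReal_mul (by norm_num)]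
  exact ENNReal.ofReal_le_ofReal (nine_mul_idleFrac_le_iprF _ _ _ _)

/-- **H1 ⇒ the mean idle fraction vanishes** on every admissible window, at every window end `t > 0`. -/
theorem tendsto_lintegral_idleFrac {a₀ θ₀ : T3 → ℝ} {u₀ : T3 → V3} {Φ : Flows σ}
    (hD : DiffuseAt σ a₀ θ₀ u₀ Φ) {Δ : ℕ → ℝ} (hΔ0 : ∀ N, 0 < Δ N) (hΔ : Tendsto Δ atTop (𝓝 0))
    (hΔg : Tendsto (fun N : ℕ => Δ N * ((N + 1 : ℕ) : ℝ) ^ ((1 : ℝ) / 3)) atTop atTop) {t : ℝ} (ht : 0 < t) :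
    Tendsto (fun N : ℕ => ∫⁻ z, ENNReal.ofReal (idleFrac σ N ((Φ N).flow (t - Δ N) z) (Δ N))
      ∂(localGibbsLaw σ a₀ u₀ θ₀ N (Φ N))) atTop (𝓝 0) := by
  have hipr := hD Δ hΔ0 hΔ hΔg t ht
  set I : ℕ → ℝ≥0∞ := fun N => ∫⁻ z, ENNReal.ofReal (idleFrac σ N ((Φ N).flow (t - Δ N) z) (Δ N))
      ∂(localGibbsLaw σ a₀ u₀ θ₀ N (Φ N)) with hIdef
  have hle : ∀ N, 9 * I N ≤ ∫⁻ z, ENNReal.ofReal (iprF σ N ((Φ N).flow (t - Δ N) z) (Δ N))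
      ∂(localGibbsLaw σ a₀ u₀ θ₀ N (Φ N)) := fun N => lintegral_idleFrac_le Φ _ (Δ N) t
  have h9 : Tendsto (fun N => 9 * I N) atTop (𝓝 0) :=
    tendsto_of_tendsto_of_tendsto_of_le_of_le tendsto_const_nhds hipr (fun N => zero_le) hle
  have h91 : Tendsto (fun N => 9⁻¹ * (9 * I N)) atTop (𝓝 (9⁻¹ * 0)) :=
    ENNReal.Tendsto.const_mul h9 (Or.inr (ENNReal.inv_ne_top.2 (by norm_num : (9 : ℝ≥0∞) ≠ 0)))
  rw [mul_zero] at h91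
  refine h91.congr fun N => ?_
  rw [← mul_assoc, ENNReal.inv_mul_cancel (by norm_num) (by norm_num), one_mul]

/-- MARKOV for the idle fraction through the measurable window ipr: `P{ε < idleFrac} ≤ E[iprF] / (9ε)`. -/
theorem measure_idleFrac_gt_le (Φ : Flows σ) (hG : (Torus.geometry (Fin 3)).IsHardSphereRegular (hsDiameter σ N))
    (P : Measure (Cfg N)) {ε : ℝ} (hε : 0 < ε) (Δ t : ℝ) :
    P {z | ε < idleFrac σ N ((Φ N).flow (t - Δ) z) Δ} ≤
      (∫⁻ z, ENNReal.ofReal (iprF σ N ((Φ N).flow (t - Δ) z) Δ) ∂P) / ENNReal.ofReal (9 * ε) := by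
  have hmeas : Measurable fun z : Cfg N => ENNReal.ofReal (iprF σ N ((Φ N).flow (t - Δ) z) Δ) :=
    ((SustainedAnisotropy.WindowOfUI.measurable_iprF hG Δ).comp ((Φ N).measurable_flow (t - Δ))).ennreal_ofReal
  calc P {z | ε < idleFrac σ N ((Φ N).flow (t - Δ) z) Δ}
      ≤ P {z | ENNReal.ofReal (9 * ε) ≤ ENNReal.ofReal (iprF σ N ((Φ N).flow (t - Δ) z) Δ)} := by
        refine measure_mono fun z hz => ENNReal.ofReal_le_ofReal ?_
        have h := nine_mul_idleFrac_le_iprF σ N ((Φ N).flow (t - Δ) z) Δ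
        simp only [mem_setOf_eq] at hz
        nlinarith [hz, h]
    _ ≤ _ := meas_ge_le_lintegral_div hmeas.aemeasurable (ENNReal.ofReal_pos.2 (by positivity)).ne'
        ENNReal.ofReal_ne_top

/-- **H1 ⇒ `P{ε < idleFrac} → 0`** on every admissible window, at every window end `t > 0`, for every `ε > 0`
(`0 < σ < 1/2` makes the torus geometry regular, which the measurability of `iprF` uses). -/
theorem tendsto_measure_idleFrac_gt {a₀ θ₀ : T3 → ℝ} {u₀ : T3 → V3} (hσ : 0 < σ) (hσ2 : σ < 2⁻¹) {Φ : Flows σ}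
    (hD : DiffuseAt σ a₀ θ₀ u₀ Φ) {Δ : ℕ → ℝ} (hΔ0 : ∀ N, 0 < Δ N) (hΔ : Tendsto Δ atTop (𝓝 0))
    (hΔg : Tendsto (fun N : ℕ => Δ N * ((N + 1 : ℕ) : ℝ) ^ ((1 : ℝ) / 3)) atTop atTop) {t : ℝ} (ht : 0 < t)
    {ε : ℝ} (hε : 0 < ε) :
    Tendsto (fun N : ℕ => localGibbsLaw σ a₀ u₀ θ₀ N (Φ N)
      {z | ε < idleFrac σ N ((Φ N).flow (t - Δ N) z) (Δ N)}) atTop (𝓝 0) := by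
  have hG : ∀ N, (Torus.geometry (Fin 3)).IsHardSphereRegular (hsDiameter σ N) := fun N =>
    Torus.isHardSphereRegular_geometry ((hsDiameter_le hσ.le N).trans_lt hσ2)
  have hipr := hD Δ hΔ0 hΔ hΔg t ht
  have hlim : Tendsto (fun N => (∫⁻ z, ENNReal.ofReal (iprF σ N ((Φ N).flow (t - Δ N) z) (Δ N))
      ∂(localGibbsLaw σ a₀ u₀ θ₀ N (Φ N))) / ENNReal.ofReal (9 * ε)) atTop (𝓝 0) := by
    have h := ENNReal.Tendsto.div_const hipr (b := ENNReal.ofReal (9 * ε))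
      (Or.inr (ENNReal.ofReal_pos.2 (by positivity)).ne')
    simpa only [ENNReal.zero_div] using h
  exact tendsto_of_tendsto_of_tendsto_of_le_of_le tendsto_const_nhds hlim (fun _ => zero_le)
    fun N => measure_idleFrac_gt_le Φ (hG N) _ hε (Δ N) t

/-! ## The diagonal sequence -/

/-- **Diagonal sequence.** If `u η N → 0` (`N → ∞`) for every fixed level `η > 0`, then along some sequence of
levels `η_N > 0`, `η_N → 0`, still `u η_N N → 0`. (Levels `1/(k+1)`; `M k` a threshold beyond which
`u (1/(k+1)) N ≤ 1/(k+1)`; `K N` the largest `k ≤ N` whose cumulated threshold is `≤ N`.) -/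
theorem exists_diag_seq {u : ℝ → ℕ → ℝ≥0∞} (h : ∀ η : ℝ, 0 < η → Tendsto (u η) atTop (𝓝 0)) :
    ∃ η : ℕ → ℝ, (∀ N, 0 < η N) ∧ Tendsto η atTop (𝓝 0) ∧ Tendsto (fun N => u (η N) N) atTop (𝓝 0) := by
  -- levels `lev k = 1/(k+1)` and thresholds
  set lev : ℕ → ℝ := fun k => 1 / ((k : ℝ) + 1) with hlev
  have hlev0 : ∀ k, 0 < lev k := fun k => by rw [hlev]; positivity
  have hk : ∀ k : ℕ, ∃ M : ℕ, ∀ N, M ≤ N → u (lev k) N ≤ ENNReal.ofReal (lev k) := by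
    intro k
    have hev := ENNReal.tendsto_nhds_zero.1 (h (lev k) (hlev0 k)) (ENNReal.ofReal (lev k))
      (ENNReal.ofReal_pos.2 (hlev0 k))
    obtain ⟨M, hM⟩ := eventually_atTop.1 hev
    exact ⟨M, hM⟩
  choose M hM using hk
  -- cumulated (monotone) thresholds
  set M' : ℕ → ℕ := fun k => ∑ j ∈ Finset.range (k + 1), M j with hM'
  have hMM' : ∀ k, M k ≤ M' k := fun k => by
    rw [hM']
    exact Finset.single_le_sum (fun j _ => Nat.zero_le (M j)) (Finset.self_mem_range_succ k)
  have hM'mono : Monotone M' := fun a b hab => by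
    rw [hM']
    exact Finset.sum_le_sum_of_subset (Finset.range_subset_range.2 (by omega))
  -- `K N` = the largest `k ≤ N` with `M' k ≤ N`
  set K : ℕ → ℕ := fun N => Nat.findGreatest (fun k => M' k ≤ N) N with hK
  have hKspec : ∀ N, M' 0 ≤ N → M' (K N) ≤ N := by
    intro N hN
    by_cases hK0 : K N = 0
    · rw [hK0]; exact hN
    · exact Nat.findGreatest_of_ne_zero (P := fun k => M' k ≤ N) (n := N) (m := K N) rfl hK0
  have hKge : ∀ k N, M' k ≤ N → k ≤ N → k ≤ K N := fun k N h1 h2 =>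
    Nat.le_findGreatest h2 h1
  refine ⟨fun N => lev (K N), fun N => hlev0 _, ?_, ?_⟩
  · -- `η_N → 0` since `K N → ∞`
    have hKtop : Tendsto K atTop atTop := by
      refine tendsto_atTop_atTop.2 fun k => ⟨max (M' k) k, fun N hN => ?_⟩
      exact hKge k N ((le_max_left _ _).trans hN) ((le_max_right _ _).trans hN)
    have hlevT : Tendsto lev atTop (𝓝 0) := by
      rw [hlev]
      exact tendsto_one_div_add_atTop_nhds_zero_nat
    exact hlevT.comp hKtop
  · rw [ENNReal.tendsto_nhds_zero]
    intro e he
    -- eventually `ofReal (lev (K N)) ≤ e` and `M (K N) ≤ N`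
    have hKtop : Tendsto K atTop atTop := by
      refine tendsto_atTop_atTop.2 fun k => ⟨max (M' k) k, fun N hN => ?_⟩
      exact hKge k N ((le_max_left _ _).trans hN) ((le_max_right _ _).trans hN)
    have hlevT : Tendsto (fun N => ENNReal.ofReal (lev (K N))) atTop (𝓝 0) := by
      have h1 : Tendsto lev atTop (𝓝 0) := by
        rw [hlev]
        exact tendsto_one_div_add_atTop_nhds_zero_nat
      have h2 := ENNReal.tendsto_ofReal (h1.comp hKtop)
      rwa [ENNReal.ofReal_zero] at h2
    have hev1 : ∀ᶠ N in atTop, ENNReal.ofReal (lev (K N)) ≤ e :=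
      ENNReal.tendsto_nhds_zero.1 hlevT e he
    have hev2 : ∀ᶠ N in atTop, M' 0 ≤ N := eventually_ge_atTop _
    filter_upwards [hev1, hev2] with N h1 h2
    have h3 : M (K N) ≤ N := (hMM' (K N)).trans (hKspec N h2)
    exact (hM (K N) N h3).trans h1

end ContactToMass

/-- Registration anchor of this helper file (`--supports stmt-AtomisticToContinuum-14868`, stub
`stub_contactToMass`, file 1): H1 (`DiffuseAt`) forces the local-Gibbs probability of an idle fraction above any
fixed level to vanish on every admissible window at every window end — the `∀`-closed form of
`ContactToMass.tendsto_measure_idleFrac_gt`. -/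
theorem bhContactToMass_idle_anchor : ∀ (σ : ℝ) (a₀ θ₀ : T3 → ℝ) (u₀ : T3 → V3), 0 < σ → σ < 2⁻¹ →
    ∀ Φ : Flows σ, DiffuseAt σ a₀ θ₀ u₀ Φ → ∀ Δ : ℕ → ℝ, (∀ N, 0 < Δ N) → Tendsto Δ atTop (𝓝 0) →
      Tendsto (fun N : ℕ => Δ N * ((N + 1 : ℕ) : ℝ) ^ ((1 : ℝ) / 3)) atTop atTop → ∀ t : ℝ, 0 < t →
        ∀ ε : ℝ, 0 < ε → Tendsto (fun N : ℕ => localGibbsLaw σ a₀ u₀ θ₀ N (Φ N)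
          {z | ε < idleFrac σ N ((Φ N).flow (t - Δ N) z) (Δ N)}) atTop (𝓝 0) :=
  fun _ _ _ _ hσ hσ2 _ hD _ hΔ0 hΔ hΔg _ ht _ hε =>
    ContactToMass.tendsto_measure_idleFrac_gt hσ hσ2 hD hΔ0 hΔ hΔg ht hε

end

end Summit.AtomisticToContinuum.HydrodynamicLimit.Theorems.BlockHDissipation
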